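import Summits.NavierStokesRegularity.NavierStokesRegularity.Theorems.AxisymmetricExtremalityAxisymmetricKatoGlobalStubSeregin2020TypeIILemma22PieceSummary
import Summits.NavierStokesRegularity.NavierStokesRegularity.Theorems.AxisymmetricExtremalityAxisymmetricKatoGlobalStubSeregin2020TypeIILemma22CutTelescoping
import Summits.NavierStokesRegularity.NavierStokesRegularity.Theorems.AxisymmetricExtremalityAxisymmetricKatoGlobalStubSeregin2020TypeIILemma22SliceMasses
import HarnessLib

/-!
# L22-B, piece F3c (6/·): the telescoped inequality of one cover

Seregin 2020 Lemma 2.2 ⇐ N–U 2012 Lemma 4.2 for the class `𝒱` (cell ns-inputs, kit A1-L22B-F3, route P).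
For ONE finite cover of `S ∩ ([t₁,t₂] × B̄(0,2R))` by cylinders `Q*_{rᵢ}(zᵢ)` with its ball bumps `ψᵢ`,
the sorted partition `τ` of `[t₁,t₂]` by the enlarged endpoints, active sets `A m` and product cut-offs
`φ m = ∏_{i∈A m}(1-ψᵢ)`, `cover_telescoped` sums the per-piece inequalities (`pieceEnergy_summary`) with
`telescope_pieces`, pays the junction jumps and the two endpoint corrections with ser-a's
`sliceMass_prodCut_facts` and es-p1's switching count `sum_activeSwitch_le`, and merges the gradient and
`|η'|` terms over the pieces (`sum_setIntegral_Icc_prod_univ`):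
`η(t₂)M(t₂) + Σ_m D_m ≤ η(t₁)M(t₁) + (1+σ)·4∫T₁ + Σ_m ∫_{L_m} φ_m²T₂ + Σ_m ∫_{L_m} φ_m²T₃ + ∫T₄
  + (1+σ⁻¹)·4·Σ e₁ + Σ e₂ + Σ e₃ + 3·Cη·H(0)·CΘ²·Σᵢ |B(xᵢ,4rᵢ)|`.
[cite: NazarovUraltseva2012, §3 (3.9), Remark 9; Seregin2020, Lemma 2.2]

Nothing here is a Navier–Stokes regularity statement.
-/

noncomputable section

set_option linter.dupNamespace false

open MeasureTheory Set Function Filter Topology TopologicalSpace Metric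
open scoped NNReal ENNReal InnerProductSpace RealInnerProductSpace

namespace Summit.NavierStokesRegularity.NavierStokesRegularity.Theorems.AxisymmetricKatoGlobal.EulerScaling

open Literature.Analysis.FluidPDE Literature.Analysis.FluidPDE.Seregin2020

/-- Shifted switching sums: `Σ_{m<p} g(m-1, m) ≤ Σ_{m<p} g(m, m+1)` for `g ≥ 0` with `g(0,0)`-term
vanishing (natural subtraction at `m = 0`). [folklore] -/
theorem sum_range_pred_le {g : ℕ → ℕ → ℝ} (hg : ∀ m m', 0 ≤ g m m') (h0 : g 0 0 = 0) (p : ℕ) :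
    ∑ m ∈ Finset.range p, g (m - 1) m ≤ ∑ m ∈ Finset.range p, g m (m + 1) := by
  cases p with
  | zero => simp
  | succ q =>
    rw [Finset.sum_range_succ' (fun m => g (m - 1) m), Finset.sum_range_succ]
    simp only [Nat.add_sub_cancel, Nat.zero_sub, h0, add_zero]
    linarith [hg q (q + 1)]

/-- **The telescoped inequality of one cover** (module docstring). -/
theorem cover_telescoped
    -- class-𝒱 data
    {U : ℝ → EuclideanSpace ℝ (Fin 3) → EuclideanSpace ℝ (Fin 3)} {Φ : ℝ → EuclideanSpace ℝ (Fin 3) → ℝ}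
    {S : Set (ℝ × EuclideanSpace ℝ (Fin 3))} {R k : ℝ}
    (hUc : ContinuousOn (uncurry U) {z : ℝ × EuclideanSpace ℝ (Fin 3) | z.1 < 0 ∧ cylRadius z.2 ≠ 0})
    (hUs : ∀ z : ℝ × EuclideanSpace ℝ (Fin 3), z.1 < 0 → cylRadius z.2 ≠ 0 → ContDiffAt ℝ (⊤ : ℕ∞) (U z.1) z.2)
    (hdivU : ∀ z : ℝ × EuclideanSpace ℝ (Fin 3), z.1 < 0 → cylRadius z.2 ≠ 0 →
      VectorCalculus.divergence (U z.1) z.2 = 0)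
    (hU3 : ∀ a : ℝ, 0 < a → ∫⁻ z in parabolicCylinder a (0 : ℝ × EuclideanSpace ℝ (Fin 3)), ‖U z.1 z.2‖ₑ ^ (3 : ℕ) < ∞)
    (hSc : IsClosed S) (hSax : ∀ z ∈ S, z.1 ≤ 0 ∧ cylRadius z.2 = 0)
    (hΦc : ContinuousOn (uncurry Φ) ({z : ℝ × EuclideanSpace ℝ (Fin 3) | z.1 < 0} \ S))
    (hΦs : ∀ z : ℝ × EuclideanSpace ℝ (Fin 3), z.1 < 0 → z ∉ S → ContDiffAt ℝ (⊤ : ℕ∞) (Φ z.1) z.2)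
    (hΦg : ContinuousOn (fun z : ℝ × EuclideanSpace ℝ (Fin 3) => fderiv ℝ (Φ z.1) z.2)
      ({z : ℝ × EuclideanSpace ℝ (Fin 3) | z.1 < 0} \ S))
    (hΦt : ∀ z : ℝ × EuclideanSpace ℝ (Fin 3), z.1 < 0 → cylRadius z.2 ≠ 0 → DifferentiableAt ℝ (fun r => Φ r z.2) z.1)
    (hΦt' : ContinuousOn (fun z : ℝ × EuclideanSpace ℝ (Fin 3) => deriv (fun r => Φ r z.2) z.1)
      {z : ℝ × EuclideanSpace ℝ (Fin 3) | z.1 < 0 ∧ cylRadius z.2 ≠ 0})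
    (hΦ0 : ∀ z : ℝ × EuclideanSpace ℝ (Fin 3), z.1 < 0 → z ∉ S → 0 ≤ Φ z.1 z.2)
    (hsup : ∀ z : ℝ × EuclideanSpace ℝ (Fin 3), z.1 < 0 → cylRadius z.2 ≠ 0 →
      0 ≤ deriv (fun r => Φ r z.2) z.1 + fderiv ℝ (Φ z.1) z.2 (U z.1 z.2) +
          2 / cylRadius z.2 * partialDeriv (eR z.2) (Φ z.1) z.2 - (Laplacian.laplacian (Φ z.1)) z.2)
    (hR : 0 < R) (hk0 : 0 < k)
    (hk : ∀ z : ℝ × EuclideanSpace ℝ (Fin 3), z.1 ∈ Ioo (-R ^ 2) 0 → cylRadius z.2 = 0 →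
      z.2 2 ∈ Ioo (-(2 * R)) (2 * R) → z ∉ S → k ≤ Φ z.1 z.2)
    -- the normalised pair
    {Φ' : ℝ → EuclideanSpace ℝ (Fin 3) → ℝ} {U' : ℝ → EuclideanSpace ℝ (Fin 3) → EuclideanSpace ℝ (Fin 3)}
    (hΦ'1 : ∀ t x, t < 0 → (t, x) ∉ S → Φ' t x = Φ t x) (hΦ'2 : ∀ t x, ¬ (t < 0 ∧ (t, x) ∉ S) → Φ' t x = k)
    (hU'1 : ∀ t x, t < 0 → cylRadius x ≠ 0 → U' t x = U t x)
    -- profile, test function, time weight, splitting parameter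
    {H : ℝ → ℝ} (hH : ContDiff ℝ 2 H) (hH' : ∀ v, deriv H v ≤ 0) (hH0 : ∀ v, 0 ≤ H v)
    (hH2 : ∀ v, 0 ≤ deriv (deriv H) v) (hκ : ∀ v, deriv H v ^ 2 ≤ 2 * H v * deriv (deriv H) v)
    (hHk : ∀ v, k ≤ v → H v = 0)
    {Θ : EuclideanSpace ℝ (Fin 3) → ℝ} (hΘ : ContDiff ℝ 1 Θ) (hΘc : HasCompactSupport Θ)
    (hΘO : tsupport Θ ⊆ ball (0 : EuclideanSpace ℝ (Fin 3)) (2 * R)) {CΘ : ℝ} (hCΘ : ∀ y, |Θ y| ≤ CΘ)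
    {η : ℝ → ℝ} (hη : ContDiff ℝ 1 η) (hη0 : ∀ s, 0 ≤ η s) {t₁ t₂ : ℝ} (ht₁ : -R ^ 2 < t₁) (ht₂ : t₂ < 0)
    {Cη : ℝ} (hCη : ∀ t ∈ Icc t₁ t₂, η t ≤ Cη) {σ : ℝ} (hσ : 0 < σ)
    -- the cover, its bumps, its partition, the active sets and cut-offs
    {s : Finset ℕ} {z : ℕ → ℝ × EuclideanSpace ℝ (Fin 3)} {r : ℕ → ℝ} (hr : ∀ i ∈ s, 0 < r i)
    (hcov : S ∩ (Icc t₁ t₂ ×ˢ closedBall (0 : EuclideanSpace ℝ (Fin 3)) (2 * R)) ⊆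
      ⋃ i ∈ s, parabolicCylinderCentered (r i) (z i))
    {ψ : ℕ → EuclideanSpace ℝ (Fin 3) → ℝ} (hψC : ∀ i ∈ s, ContDiff ℝ 1 (ψ i))
    (hψ01 : ∀ i ∈ s, ∀ y, 0 ≤ ψ i y ∧ ψ i y ≤ 1)
    (hψ1 : ∀ i ∈ s, ∀ y ∈ closedBall (z i).2 (2 * r i), ψ i y = 1)
    (hψ0 : ∀ i ∈ s, ∀ y, y ∉ ball (z i).2 (4 * r i) → ψ i y = 0)
    {p : ℕ} {τ : ℕ → ℝ} (hτ : Monotone τ) (hτ0 : τ 0 = t₁) (hτp : τ p = t₂)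
    (hτE : ∀ m < p, ∀ i ∈ s, (z i).1 - 2 * r i ^ 2 ∉ Ioo (τ m) (τ (m + 1)) ∧ (z i).1 + 2 * r i ^ 2 ∉ Ioo (τ m) (τ (m + 1)))
    {A : ℕ → Finset ℕ} (hA : ∀ m, A m = s.filter fun i => (z i).1 - 2 * r i ^ 2 ≤ τ m ∧ τ (m + 1) ≤ (z i).1 + 2 * r i ^ 2)
    {φ : ℕ → EuclideanSpace ℝ (Fin 3) → ℝ} (hφ : ∀ m y, φ m y = ∏ i ∈ A m, (1 - ψ i y))
    -- integrability of the true integrands on the slab and of the error integrands on the pieces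
    (iT1 : Integrable (fun w : ℝ × EuclideanSpace ℝ (Fin 3) => η w.1 * (H (Φ' w.1 w.2) * ‖gradient Θ w.2‖ ^ 2))
      (volume.restrict (Icc t₁ t₂ ×ˢ (univ : Set (EuclideanSpace ℝ (Fin 3))))))
    (iT2 : Integrable (fun w : ℝ × EuclideanSpace ℝ (Fin 3) =>
        η w.1 * (H (Φ' w.1 w.2) * inner ℝ (U' w.1 w.2) (gradient (fun y => Θ y ^ 2) w.2)))
      (volume.restrict (Icc t₁ t₂ ×ˢ (univ : Set (EuclideanSpace ℝ (Fin 3))))))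
    (iT3 : Integrable (fun w : ℝ × EuclideanSpace ℝ (Fin 3) =>
        η w.1 * (2 / cylRadius w.2 * (H (Φ' w.1 w.2) * fderiv ℝ (fun y => Θ y ^ 2) w.2 (eR w.2))))
      (volume.restrict (Icc t₁ t₂ ×ˢ (univ : Set (EuclideanSpace ℝ (Fin 3))))))
    (iT4 : Integrable (fun w : ℝ × EuclideanSpace ℝ (Fin 3) => |deriv η w.1| * (H (Φ' w.1 w.2) * Θ w.2 ^ 2))
      (volume.restrict (Icc t₁ t₂ ×ˢ (univ : Set (EuclideanSpace ℝ (Fin 3))))))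
    (iB : ∀ m < p, Integrable (fun w : ℝ × EuclideanSpace ℝ (Fin 3) =>
        η w.1 * (H (Φ' w.1 w.2) * (Θ w.2 ^ 2 * ‖gradient (φ m) w.2‖ ^ 2)))
      (volume.restrict (Icc (τ m) (τ (m + 1)) ×ˢ (univ : Set (EuclideanSpace ℝ (Fin 3))))))
    (iD : ∀ m < p, Integrable (fun w : ℝ × EuclideanSpace ℝ (Fin 3) =>
        η w.1 * (H (Φ' w.1 w.2) * inner ℝ (U' w.1 w.2) ((Θ w.2 ^ 2) • gradient (fun y => φ m y ^ 2) w.2)))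
      (volume.restrict (Icc (τ m) (τ (m + 1)) ×ˢ (univ : Set (EuclideanSpace ℝ (Fin 3))))))
    (iF : ∀ m < p, Integrable (fun w : ℝ × EuclideanSpace ℝ (Fin 3) =>
        η w.1 * (2 / cylRadius w.2 * (H (Φ' w.1 w.2) * (Θ w.2 ^ 2 * fderiv ℝ (fun y => φ m y ^ 2) w.2 (eR w.2)))))
      (volume.restrict (Icc (τ m) (τ (m + 1)) ×ˢ (univ : Set (EuclideanSpace ℝ (Fin 3)))))) :
    (∀ m < p, (∫⁻ w in Icc (τ m) (τ (m + 1)) ×ˢ (univ : Set (EuclideanSpace ℝ (Fin 3))), ENNReal.ofReal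
        (1 / 2 * η w.1 * (deriv (deriv H) (Φ' w.1 w.2) * ‖gradient (Φ' w.1) w.2‖ ^ 2 * (Θ w.2 * φ m w.2) ^ 2))) < ⊤) ∧
    η t₂ * (∫ x, H (Φ' t₂ x) * Θ x ^ 2) +
      ∑ m ∈ Finset.range p, (∫⁻ w in Icc (τ m) (τ (m + 1)) ×ˢ (univ : Set (EuclideanSpace ℝ (Fin 3))), ENNReal.ofReal
        (1 / 2 * η w.1 * (deriv (deriv H) (Φ' w.1 w.2) * ‖gradient (Φ' w.1) w.2‖ ^ 2 * (Θ w.2 * φ m w.2) ^ 2))).toReal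
    ≤ η t₁ * (∫ x, H (Φ' t₁ x) * Θ x ^ 2) +
      (1 + σ) * (4 * ∫ w in Icc t₁ t₂ ×ˢ (univ : Set (EuclideanSpace ℝ (Fin 3))),
        η w.1 * (H (Φ' w.1 w.2) * ‖gradient Θ w.2‖ ^ 2)) +
      (∑ m ∈ Finset.range p, ∫ w in Icc (τ m) (τ (m + 1)) ×ˢ (univ : Set (EuclideanSpace ℝ (Fin 3))),
        η w.1 * (H (Φ' w.1 w.2) * (φ m w.2 ^ 2 * inner ℝ (U' w.1 w.2) (gradient (fun y => Θ y ^ 2) w.2)))) +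
      (∑ m ∈ Finset.range p, ∫ w in Icc (τ m) (τ (m + 1)) ×ˢ (univ : Set (EuclideanSpace ℝ (Fin 3))),
        η w.1 * (2 / cylRadius w.2 * (H (Φ' w.1 w.2) * (φ m w.2 ^ 2 * fderiv ℝ (fun y => Θ y ^ 2) w.2 (eR w.2))))) +
      (∫ w in Icc t₁ t₂ ×ˢ (univ : Set (EuclideanSpace ℝ (Fin 3))), |deriv η w.1| * (H (Φ' w.1 w.2) * Θ w.2 ^ 2)) +
      (1 + σ⁻¹) * (4 * ∑ m ∈ Finset.range p, ∫ w in Icc (τ m) (τ (m + 1)) ×ˢ (univ : Set (EuclideanSpace ℝ (Fin 3))),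
        η w.1 * (H (Φ' w.1 w.2) * (Θ w.2 ^ 2 * ‖gradient (φ m) w.2‖ ^ 2))) +
      (∑ m ∈ Finset.range p, ∫ w in Icc (τ m) (τ (m + 1)) ×ˢ (univ : Set (EuclideanSpace ℝ (Fin 3))),
        η w.1 * (H (Φ' w.1 w.2) * |inner ℝ (U' w.1 w.2) ((Θ w.2 ^ 2) • gradient (fun y => φ m y ^ 2) w.2)|)) +
      (∑ m ∈ Finset.range p, ∫ w in Icc (τ m) (τ (m + 1)) ×ˢ (univ : Set (EuclideanSpace ℝ (Fin 3))),
        η w.1 * (2 / cylRadius w.2 * (H (Φ' w.1 w.2) * |Θ w.2 ^ 2 * fderiv ℝ (fun y => φ m y ^ 2) w.2 (eR w.2)|))) +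
      3 * (Cη * (H 0 * CΘ ^ 2)) * ∑ i ∈ s, volume.real (ball (z i).2 (4 * r i)) := by
  classical
  -- ### notation for the per-piece quantities
  set Mcut : ℕ → ℝ → ℝ := fun m t => ∫ x, H (Φ' t x) * (Θ x * φ m x) ^ 2 with hMcut
  set Mtrue : ℝ → ℝ := fun t => ∫ x, H (Φ' t x) * Θ x ^ 2 with hMtrue
  set D : ℕ → ℝ≥0∞ := fun m => ∫⁻ w in Icc (τ m) (τ (m + 1)) ×ˢ (univ : Set (EuclideanSpace ℝ (Fin 3))),
    ENNReal.ofReal (1 / 2 * η w.1 * (deriv (deriv H) (Φ' w.1 w.2) * ‖gradient (Φ' w.1) w.2‖ ^ 2 *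
      (Θ w.2 * φ m w.2) ^ 2)) with hD
  set I1 : ℕ → ℝ := fun m => ∫ w in Icc (τ m) (τ (m + 1)) ×ˢ (univ : Set (EuclideanSpace ℝ (Fin 3))),
    η w.1 * (H (Φ' w.1 w.2) * ‖gradient Θ w.2‖ ^ 2) with hI1
  set I2 : ℕ → ℝ := fun m => ∫ w in Icc (τ m) (τ (m + 1)) ×ˢ (univ : Set (EuclideanSpace ℝ (Fin 3))),
    η w.1 * (H (Φ' w.1 w.2) * (φ m w.2 ^ 2 * inner ℝ (U' w.1 w.2) (gradient (fun y => Θ y ^ 2) w.2))) with hI2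
  set I3 : ℕ → ℝ := fun m => ∫ w in Icc (τ m) (τ (m + 1)) ×ˢ (univ : Set (EuclideanSpace ℝ (Fin 3))),
    η w.1 * (2 / cylRadius w.2 * (H (Φ' w.1 w.2) * (φ m w.2 ^ 2 * fderiv ℝ (fun y => Θ y ^ 2) w.2 (eR w.2))))
    with hI3
  set I4 : ℕ → ℝ := fun m => ∫ w in Icc (τ m) (τ (m + 1)) ×ˢ (univ : Set (EuclideanSpace ℝ (Fin 3))),
    |deriv η w.1| * (H (Φ' w.1 w.2) * Θ w.2 ^ 2) with hI4
  set E1 : ℕ → ℝ := fun m => ∫ w in Icc (τ m) (τ (m + 1)) ×ˢ (univ : Set (EuclideanSpace ℝ (Fin 3))),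
    η w.1 * (H (Φ' w.1 w.2) * (Θ w.2 ^ 2 * ‖gradient (φ m) w.2‖ ^ 2)) with hE1
  set E2 : ℕ → ℝ := fun m => ∫ w in Icc (τ m) (τ (m + 1)) ×ˢ (univ : Set (EuclideanSpace ℝ (Fin 3))),
    η w.1 * (H (Φ' w.1 w.2) * |inner ℝ (U' w.1 w.2) ((Θ w.2 ^ 2) • gradient (fun y => φ m y ^ 2) w.2)|) with hE2
  set E3 : ℕ → ℝ := fun m => ∫ w in Icc (τ m) (τ (m + 1)) ×ˢ (univ : Set (EuclideanSpace ℝ (Fin 3))),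
    η w.1 * (2 / cylRadius w.2 * (H (Φ' w.1 w.2) * |Θ w.2 ^ 2 * fderiv ℝ (fun y => φ m y ^ 2) w.2 (eR w.2)|)) with hE3
  set V : ℕ → ℝ := fun i => volume.real (ball (z i).2 (4 * r i)) with hV
  set Kc : ℝ := Cη * (H 0 * CΘ ^ 2) with hKc
  -- ### elementary facts on the partition
  have hτI : ∀ m, m ≤ p → t₁ ≤ τ m ∧ τ m ≤ t₂ := fun m hm =>
    ⟨by rw [← hτ0]; exact hτ (Nat.zero_le m), by rw [← hτp]; exact hτ hm⟩
  have hτneg : ∀ m, m ≤ p → τ m < 0 := fun m hm => lt_of_le_of_lt (hτI m hm).2 ht₂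
  have hAs : ∀ m, A m ⊆ s := fun m => by rw [hA m]; exact Finset.filter_subset _ _
  have hV0 : ∀ i, 0 ≤ V i := fun i => measureReal_nonneg
  have h12 : t₁ ≤ t₂ := by have := (hτI p le_rfl).1; rwa [hτp] at this
  have hKc0 : 0 ≤ Kc := by
    have hC1 : 0 ≤ Cη := (hη0 t₁).trans (hCη t₁ ⟨le_rfl, h12⟩)
    rw [hKc]
    exact mul_nonneg hC1 (mul_nonneg (hH0 0) (sq_nonneg _))
  have hψc : ∀ i ∈ s, Continuous (ψ i) := fun i hi => (hψC i hi).continuous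
  -- ### the per-piece inequalities
  have hpiece : ∀ m < p, D m < ⊤ ∧
      η (τ (m + 1)) * Mcut m (τ (m + 1)) + (D m).toReal ≤ η (τ m) * Mcut m (τ m) +
        (1 + σ) * (4 * I1 m) + (1 + σ⁻¹) * (4 * E1 m) + I2 m + E2 m + I3 m + E3 m + I4 m := by
    intro m hm
    have ha : t₁ ≤ τ m := (hτI m hm.le).1
    have hb : τ (m + 1) ≤ t₂ := (hτI (m + 1) hm).2
    have hab : τ m ≤ τ (m + 1) := hτ (Nat.le_succ m)
    have hsub : Icc (τ m) (τ (m + 1)) ×ˢ (univ : Set (EuclideanSpace ℝ (Fin 3))) ⊆ Icc t₁ t₂ ×ˢ univ :=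
      prod_mono (Icc_subset_Icc ha hb) Subset.rfl
    have hμle : volume.restrict (Icc (τ m) (τ (m + 1)) ×ˢ (univ : Set (EuclideanSpace ℝ (Fin 3)))) ≤
        volume.restrict (Icc t₁ t₂ ×ˢ (univ : Set (EuclideanSpace ℝ (Fin 3)))) :=
      Measure.restrict_mono hsub le_rfl
    exact pieceEnergy_summary hUc hUs hdivU hU3 hSc hSax hΦc hΦs hΦg hΦt hΦt' hsup hR hk hΦ'1 hU'1
      (fun i hi => (hr i hi)) hψC hψ01 hψ1 ht₁ ht₂ hcov ha hab hb (hτE m hm) hH hH' hH0 hH2 hκ hHk hΘ hΘc hΘO hη hη0 hσ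
      (hA m) (hφ m) (iT1.mono_measure hμle) (iT2.mono_measure hμle) (iT3.mono_measure hμle) (iT4.mono_measure hμle)
      (iB m hm) (iD m hm) (iF m hm)
  refine ⟨fun m hm => (hpiece m hm).1, ?_⟩
  -- ### the junction jumps and the endpoint corrections (slice masses)
  have hslice : ∀ t, t < 0 → ∀ m m' : ℕ,
      Integrable (fun y => H (Φ' t y) * (Θ y * ∏ i ∈ A m, (1 - ψ i y)) ^ 2) ∧
      (∫ y, H (Φ' t y) * (Θ y * ∏ i ∈ A m, (1 - ψ i y)) ^ 2) ≤ (∫ y, H (Φ' t y) * Θ y ^ 2) ∧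
      (∫ y, H (Φ' t y) * Θ y ^ 2) - (∫ y, H (Φ' t y) * (Θ y * ∏ i ∈ A m, (1 - ψ i y)) ^ 2)
        ≤ H 0 * CΘ ^ 2 * ∑ i ∈ A m, volume.real (ball (z i).2 (4 * r i)) ∧
      |(∫ y, H (Φ' t y) * (Θ y * ∏ i ∈ A m, (1 - ψ i y)) ^ 2) -
          (∫ y, H (Φ' t y) * (Θ y * ∏ i ∈ A m', (1 - ψ i y)) ^ 2)|
        ≤ H 0 * CΘ ^ 2 * (∑ i ∈ A m \ A m', volume.real (ball (z i).2 (4 * r i)) +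
          ∑ i ∈ A m' \ A m, volume.real (ball (z i).2 (4 * r i))) :=
    fun t ht m m' => sliceMass_prodCut_facts hSc hSax hΦc hΦ0 hk0 hΦ'1 hΦ'2 hH hH' hH0 hΘ hΘc hCΘ
      (x := fun i => (z i).2) hψc hψ01 hψ0 ht (hAs m) (hAs m')
  have hMcut_eq : ∀ m t, Mcut m t = ∫ y, H (Φ' t y) * (Θ y * ∏ i ∈ A m, (1 - ψ i y)) ^ 2 := by
    intro m t
    simp only [hMcut]
    refine integral_congr_ae (Eventually.of_forall fun y => ?_)
    simp only [hφ]
  -- ### telescoping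
  set e : ℕ → ℝ := fun m => Kc * (∑ i ∈ A (m - 1) \ A m, V i + ∑ i ∈ A m \ A (m - 1), V i) with he
  have htel := telescope_pieces p (fun m => η (τ m) * Mcut m (τ m)) (fun m => η (τ m) * Mcut (m - 1) (τ m))
    (fun m => (D m).toReal)
    (fun m => (1 + σ) * (4 * I1 m) + (1 + σ⁻¹) * (4 * E1 m) + I2 m + E2 m + I3 m + E3 m + I4 m) e
    (fun m hm => by
      have h := (hpiece m hm).2
      simp only [Nat.add_sub_cancel]
      linarith)
    (fun m hm => by
      have ht : τ m < 0 := hτneg m hm.le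
      have hj := (hslice (τ m) ht m (m - 1)).2.2.2
      rw [← hMcut_eq, ← hMcut_eq] at hj
      have hηb : η (τ m) ≤ Cη := hCη (τ m) (hτI m hm.le)
      have hη0' : 0 ≤ η (τ m) := hη0 _
      simp only [he, hKc]
      have hdiff : Mcut m (τ m) - Mcut (m - 1) (τ m) ≤
          H 0 * CΘ ^ 2 * (∑ i ∈ A m \ A (m - 1), V i + ∑ i ∈ A (m - 1) \ A m, V i) :=
        (le_abs_self _).trans hj
      have hS0 : 0 ≤ H 0 * CΘ ^ 2 * (∑ i ∈ A m \ A (m - 1), V i + ∑ i ∈ A (m - 1) \ A m, V i) := by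
        have : 0 ≤ ∑ i ∈ A m \ A (m - 1), V i + ∑ i ∈ A (m - 1) \ A m, V i :=
          add_nonneg (Finset.sum_nonneg fun i _ => hV0 i) (Finset.sum_nonneg fun i _ => hV0 i)
        exact mul_nonneg (mul_nonneg (hH0 0) (sq_nonneg _)) this
      nlinarith [mul_le_mul_of_nonneg_left hdiff hη0', mul_le_mul_of_nonneg_right hηb hS0])
  -- ### the switching cost
  have hswitch : ∑ m ∈ Finset.range p, e m ≤ 2 * Kc * ∑ i ∈ s, V i := by
    have hsd : ∀ m m' : ℕ, ∑ i ∈ A m \ A m', V i + ∑ i ∈ A m' \ A m, V i ≤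
        ∑ i ∈ s.filter (fun i => ¬ (((z i).1 - 2 * r i ^ 2 ≤ τ m ∧ τ (m + 1) ≤ (z i).1 + 2 * r i ^ 2) ↔
          ((z i).1 - 2 * r i ^ 2 ≤ τ m' ∧ τ (m' + 1) ≤ (z i).1 + 2 * r i ^ 2))), V i := by
      intro m m'
      have hdisj : Disjoint (A m \ A m') (A m' \ A m) := Finset.sdiff_disjoint.mono_right Finset.sdiff_subset
      rw [← Finset.sum_union hdisj]
      refine Finset.sum_le_sum_of_subset_of_nonneg ?_ (fun i _ _ => hV0 i)
      intro i hi
      simp only [Finset.mem_union, Finset.mem_sdiff, hA, Finset.mem_filter] at hi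
      rw [Finset.mem_filter]
      tauto
    have hg0 : ∀ m m' : ℕ, 0 ≤ Kc * (∑ i ∈ A m \ A m', V i + ∑ i ∈ A m' \ A m, V i) := fun m m' =>
      mul_nonneg hKc0 (add_nonneg (Finset.sum_nonneg fun i _ => hV0 i) (Finset.sum_nonneg fun i _ => hV0 i))
    have h1 : ∑ m ∈ Finset.range p, e m ≤
        ∑ m ∈ Finset.range p, Kc * (∑ i ∈ A m \ A (m + 1), V i + ∑ i ∈ A (m + 1) \ A m, V i) := by
      have := sum_range_pred_le (g := fun m m' => Kc * (∑ i ∈ A m \ A m', V i + ∑ i ∈ A m' \ A m, V i))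
        hg0 (by simp) p
      simpa only [he] using this
    have h2 : ∑ m ∈ Finset.range p, Kc * (∑ i ∈ A m \ A (m + 1), V i + ∑ i ∈ A (m + 1) \ A m, V i) ≤
        Kc * ∑ m ∈ Finset.range p, ∑ i ∈ s.filter (fun i =>
          ¬ (((z i).1 - 2 * r i ^ 2 ≤ τ m ∧ τ (m + 1) ≤ (z i).1 + 2 * r i ^ 2) ↔
            ((z i).1 - 2 * r i ^ 2 ≤ τ (m + 1) ∧ τ (m + 2) ≤ (z i).1 + 2 * r i ^ 2))), V i := by
      rw [Finset.mul_sum]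
      exact Finset.sum_le_sum fun m _ => mul_le_mul_of_nonneg_left (hsd m (m + 1)) hKc0
    have h3 := sum_activeSwitch_le hτ p s (fun i => (z i).1 - 2 * r i ^ 2) (fun i => (z i).1 + 2 * r i ^ 2) V
      (fun i _ => hV0 i)
    nlinarith [mul_le_mul_of_nonneg_left h3 hKc0]
  -- ### endpoint corrections
  have hB0 : η (τ 0) * Mcut (0 - 1) (τ 0) ≤ η t₁ * Mtrue t₁ := by
    rw [Nat.zero_sub, hτ0]
    have h := (hslice t₁ (by linarith [(hτI p le_rfl).1, hτneg p le_rfl]) 0 0).2.1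
    rw [← hMcut_eq] at h
    exact mul_le_mul_of_nonneg_left h (hη0 _)
  have hBp : η t₂ * Mtrue t₂ ≤ η (τ p) * Mcut (p - 1) (τ p) + Kc * ∑ i ∈ s, V i := by
    rw [hτp]
    have h := (hslice t₂ ht₂ (p - 1) 0).2.2.1
    rw [← hMcut_eq] at h
    have hsub : ∑ i ∈ A (p - 1), V i ≤ ∑ i ∈ s, V i :=
      Finset.sum_le_sum_of_subset_of_nonneg (hAs _) fun i _ _ => hV0 i
    have hηb : η t₂ ≤ Cη := hCη t₂ ⟨by rw [← hτ0, ← hτp]; exact hτ (Nat.zero_le p), le_rfl⟩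
    have hη0' : 0 ≤ η t₂ := hη0 _
    have hX : Mtrue t₂ - Mcut (p - 1) t₂ ≤ H 0 * CΘ ^ 2 * ∑ i ∈ s, V i :=
      h.trans (mul_le_mul_of_nonneg_left hsub (mul_nonneg (hH0 0) (sq_nonneg _)))
    have hS0 : 0 ≤ H 0 * CΘ ^ 2 * ∑ i ∈ s, V i :=
      mul_nonneg (mul_nonneg (hH0 0) (sq_nonneg _)) (Finset.sum_nonneg fun i _ => hV0 i)
    simp only [hKc]
    nlinarith [mul_le_mul_of_nonneg_left hX hη0', mul_le_mul_of_nonneg_right hηb hS0]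
  -- ### merging the gradient and `|η'|` terms over the pieces
  have hτstep : ∀ m < p, τ m ≤ τ (m + 1) := fun m _ => hτ (Nat.le_succ m)
  have hsum1 : ∑ m ∈ Finset.range p, I1 m =
      ∫ w in Icc t₁ t₂ ×ˢ (univ : Set (EuclideanSpace ℝ (Fin 3))), η w.1 * (H (Φ' w.1 w.2) * ‖gradient Θ w.2‖ ^ 2) := by
    have h := sum_setIntegral_Icc_prod_univ p τ hτstep (f := fun w => η w.1 * (H (Φ' w.1 w.2) * ‖gradient Θ w.2‖ ^ 2))
      (by rw [hτ0, hτp]; exact iT1)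
    rw [hτ0, hτp] at h
    exact h
  have hsum4 : ∑ m ∈ Finset.range p, I4 m =
      ∫ w in Icc t₁ t₂ ×ˢ (univ : Set (EuclideanSpace ℝ (Fin 3))), |deriv η w.1| * (H (Φ' w.1 w.2) * Θ w.2 ^ 2) := by
    have h := sum_setIntegral_Icc_prod_univ p τ hτstep (f := fun w => |deriv η w.1| * (H (Φ' w.1 w.2) * Θ w.2 ^ 2))
      (by rw [hτ0, hτp]; exact iT4)
    rw [hτ0, hτp] at h
    exact h
  -- ### bookkeeping
  have hX : ∑ m ∈ Finset.range p, ((1 + σ) * (4 * I1 m) + (1 + σ⁻¹) * (4 * E1 m) + I2 m + E2 m + I3 m + E3 m + I4 m + e m) =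
      (1 + σ) * (4 * ∑ m ∈ Finset.range p, I1 m) + (1 + σ⁻¹) * (4 * ∑ m ∈ Finset.range p, E1 m) +
      ∑ m ∈ Finset.range p, I2 m + ∑ m ∈ Finset.range p, E2 m + ∑ m ∈ Finset.range p, I3 m +
      ∑ m ∈ Finset.range p, E3 m + ∑ m ∈ Finset.range p, I4 m + ∑ m ∈ Finset.range p, e m := by
    simp only [Finset.sum_add_distrib, Finset.mul_sum]
  rw [hX, hsum1, hsum4] at htel
  have hfinal := htel
  linarith [hB0, hBp, hswitch, hfinal]

end Summit.NavierStokesRegularity.NavierStokesRegularity.Theorems.AxisymmetricKatoGlobal.EulerScaling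

end
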